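import Summits.BirchSwinnertonDyer.BirchSwinnertonDyer.Theses.ThetaPartnerAtTwo
import Summits.BirchSwinnertonDyer.BirchSwinnertonDyer.Theorems.ThetaPartnerAtTwoSignedKatoUpToAtTwoPlusHondaWithLog
import Summits.BirchSwinnertonDyer.BirchSwinnertonDyer.Theorems.ThetaPartnerAtTwoSignedKatoUpToAtTwoLocalCyclotomicVariable
import HarnessLib

/-!
# Route `ThetaPartnerAtTwo` (TP2), K2 column — the HOLD item C1 `KatoZetaErlKSideCMAtTwoSupply` (stmt-BirchSwinnertonDyer-28306 =
# registered stub `stub_zetaErlKSideCMTwo` of line `rankzero` v21 = crux workfile `…OfPubOfFlat/KZHold.lean` `KZText`, verbatim)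
# FROM ITS PRINT CORE ON THE DISPLAYED HONDA SYSTEM: the local generator `g` and the Honda clauses (L)(TR)(GEN)(GEN₀) are TREE THEOREMS

Seat `bsd-input-kz-cm-two` g0 (literature-prover, cell `pub/bsd-wall/bsd-inputs`, LADDER-BSD «inputs → unconditional»). HONEST FRAMING:
theorems only (no definition, no named fact, no instance, no `sorry`); every theorem is an implication displaying its hypothesis; the
item 28306 is NOT closed by this file and no summit statement (BSD) is proved by it — proving the displayed hypothesis would make C1, hence
the K2 column's K2R0P♭ (26471) and K2r0P (24945), unconditional AS TYPED and nothing more.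

## What is here

C1 = KZ reads: for every CM habitat member `A/ℚ` off the unit zone, every cyclotomic datum, newform, period ratio, Pollack pair, fine dual
`Y`, height-one `𝔭′ ∌ 2`, pinned `I = 𝐇¹_Γ(T₂A)` and layer pairing family `pair` with (P1)(P2)(P3):
`∃ g (hg : κ.IsTopGenerator (res g)) d s, (L) ∧ (TR) ∧ (GEN) ∧ (GEN₀) ∧ (ERL_pair)(s; g, d) ∧ Nonempty (KatoDescent.KSideDatum I Y s 𝔭′)`.
Of these, the local generator and the four Honda clauses are ALREADY THEOREMS of the tree, CM-blind and valid at `p = 2`: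

* `SignedEC.PlusLayer.plusHondaSystemTwo_adicCompletion_withLog` (K3 lineage, file `…SignedKatoUpToAtTwoPlusHondaWithLog`): for `W/ℚ`
  globally minimal with `GoodSS W 2`, `a₂ = 0`, the cyclotomic `κ` and `v ∋ 2` — the `2`-adic frame `Φ : ℚ̄₂ ≃ₐ[ℚ] ℚ̄_v` over
  `φ : ℚ_[2] ≃+* ℚ_v`, `ι : ℚ̄ → ℚ̄₂` with `closureEmb ℚ_v = Φ ∘ ι`, the tower points `c_m` with `Λ(c_m) = ℓ_m`, inverters `σ_m`, the
  plus Honda system `d₀ n = 3•(c_{n+2} + σ_{n+2}•c_{n+2}) − 2•c_1`, `d = Φ_* d₀`, and (L)(TR)(GEN)(GEN₀) for `d` (Kobayashi 2003 §8.4 shape,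
  re-proved at `2` in the tree; Kobayashi prints `p` odd, p. 4).
* `SignedKatoOffTwo.LocalVar.exists_localVariable_two` (file `…SignedKatoUpToAtTwoLocalCyclotomicVariable`): `g₀ ∈ Γ_{ℚ₂}`, `g = Φ g₀ Φ⁻¹ ∈ Γ_{ℚ_v}`
  with `κ.IsTopGenerator (res g)` (the binder `hg`), `χ₂(g₀) = χ₂(g) = 5`, `g₀ʲ ζ_{2^m} = ζ_{2^m}^{5ʲ}`, `Φ_*(g₀ʲ P) = gʲ Φ_* P`.

Hence C1 follows from its PRINT CORE «(ERL_pair) ∧ K-side datum» stated FOR THE DISPLAYED `(Φ, φ, ι, c, σ, d₀, d, g₀, g)` — the hypothesis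
`hX` of `katoZetaErlKSideCMAtTwoSupply_of_erlKSideOnDisplayedHonda` below, which quantifies over exactly the output clauses of the two tree
theorems (so that a future discharge may read the logarithms `Λ(c_m) = ℓ_m` and the action `g₀ ↦ 5`, as the K3 socket
`KatoBK.corePairChiPrim_of_coreKZ_of_bricks` does) and asks only for Kato's class `s ∈ 𝐇¹_Γ(T₂A)` with (ERL_pair)(s; g, d) and
`Nonempty (KSideDatum I Y s 𝔭′)`. DESIGN NOTE (why `d` is pinned and not «every Honda system»): (L)(TR)(GEN)(GEN₀) are invariant under
`d ↦ d + 2R` for any trace-compatible family `R`, which moves the pairing sums `P_{n,d_n}` by `2P_{n,R_n}` — (ERL_pair) is a statement about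
Kobayashi's points (their logarithms), not about the axioms (L)–(GEN₀); the «∀ Honda system» variant would over-claim print.

PRINT behind `hX` (the honest residual, one class `s`, two sources): (E) Kato 2004 Thm. 12.5 (1) (p. 221) for the CM newform `f_A` — by §15.16
(p. 265) «12.5 (1)(2), 12.6 are proved by the same arguments as 13.9–13.13» for `K ⊄ ℚ(ζ_{2^∞})` — composed with (15.16.1) (p. 265: the map
(15.12.1) sends `z_{p^∞𝔣} ⊗ γ ⊗ (…)(−1)` to `z^{(p)}_{γ′}`) and read on the layer pairing à la Kobayashi (8.23)/Prop. 8.25/8.26 (pp. 18, 24–25;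
printed for odd `p` — at `2` this dictionary is KERNEL work, the `γ`-type re-cut of the K3 socket); (K) Kato §15.1 (p. 251), §15.5–15.6
(pp. 253–255), Lemma 15.13 (p. 264), §15.15 and Prop. 15.17 (p. 265) with Johnson-Leung–Kings 2011 Thm. 5.2 («for all primes p with no
exceptions») and Thm. 5.7 at the regular primes (§7.2, Def. 7.5) — the fields of `KatoDescent.KSideDatum` / `CycTransportSocket`.

References: [Kato2004Asterisque] K. Kato, Astérisque 295 (2004), Thm. 12.5 (pp. 221–222), §15.1 (p. 251), §15.12 (p. 263), Lemma 15.13 (p. 264),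
§15.15–15.16, (15.16.1), Prop. 15.17 (p. 265); [Kobayashi2003] S. Kobayashi, Invent. Math. 152 (2003), §8.4, (8.23) (p. 18), Prop. 8.25–8.26
(pp. 24–25); [JohnsonLeungKings2011] J. Johnson-Leung, G. Kings, J. reine angew. Math. 653 (2011), Thm. 5.2, Thm. 5.7, §7.2;
[KuriharaOtsuki2006] §1.3, Prop. 1.4; [Otsuki2009].
-/

set_option autoImplicit false
-- the Theorems namespace of this sub repeats the summit name by design (D-0017 nested layout)
set_option linter.dupNamespace false

noncomputable section

open scoped Classical NumberField MatrixGroups ModularForm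

open NumberField IsDedekindDomain CongruenceSubgroup WeierstrassCurve Field Literature Literature.NumberTheory.EllipticCurves
  Literature.NumberTheory.GaloisRepresentations Literature.NumberTheory.EllipticCurves.ModularForms
  Literature.NumberTheory.EllipticCurves.Rank1Residual Literature.NumberTheory.EllipticCurves.IwasawaDual
  Literature.NumberTheory.EllipticCurves.Kobayashi2003 Literature.NumberTheory.EllipticCurves.Module
  Literature.NumberTheory.EllipticCurves.Kato2004 Literature.NumberTheory.EllipticCurves.Kato2004.EulerSystemValues
  Literature.NumberTheory.EllipticCurves.GreenbergSelmer Literature.NumberTheory.EllipticCurves.Sprung2012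
  Literature.NumberTheory.EllipticCurves.FormalGroupChart
  ZpExtension Summit.BirchSwinnertonDyer.Rank1Residual.Supersingular
  Summit.BirchSwinnertonDyer.Rank1Residual.Additive Summit.BirchSwinnertonDyer.Rank1Residual.Additive.PadicCyclotomicTower
  Summit.BirchSwinnertonDyer.Rank1Residual.Additive.BallEval Summit.BirchSwinnertonDyer.Rank1Residual.Additive.LocalTransport
  Summit.BirchSwinnertonDyer.BirchSwinnertonDyer.Theorems.SignedKatoOffTwo
  Summit.BirchSwinnertonDyer.BirchSwinnertonDyer.Theorems.SignedKatoOffTwo.LocalTwo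

namespace Summit.BirchSwinnertonDyer.BirchSwinnertonDyer.Theorems.KatoZetaErlKSideCMAtTwo

open Rat.HeightOneSpectrum

set_option maxHeartbeats 400000 in
/-- **KZ ⟸ its print core on the displayed Honda system (the KZ text VERBATIM as conclusion).** For every context of the registered stub
`stub_zetaErlKSideCMTwo` (= C1 `KatoZetaErlKSideCMAtTwoSupply`, stmt-BirchSwinnertonDyer-28306): IF for the DISPLAYED `2`-adic frame
`(Φ, φ, ι)`, tower points `c`, inverters `σ`, plus Honda system `d₀`, `d = Φ_* d₀` (all output clauses of
`SignedEC.PlusLayer.plusHondaSystemTwo_adicCompletion_withLog`) and the DISPLAYED local variable `(g₀, g)` (all output clauses of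
`SignedKatoOffTwo.LocalVar.exists_localVariable_two`) there is a class `s ∈ 𝐇¹_Γ(T₂A)` with (ERL_pair)(s; g, d) — Kato's explicit reciprocity
law for the `γ`-type zeta element of `f_A` read on the layer pairing against the Mazur–Tate elements, `μ, ν ∉ 𝔭′` — and ONE K-side datum
`KatoDescent.KSideDatum I Y s 𝔭′` (hypothesis `hX`, PRINT: Kato Thm. 12.5 (1) + (15.16.1), §15; JLK Thm. 5.7 §7.2), THEN the stub holds:
`g`, `hg`, `d` and (L)(TR)(GEN)(GEN₀) are supplied by the two tree theorems. CONDITIONAL on `hX`; closes nothing by itself; BSD is not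
proved by this. [cite: Kato2004Asterisque, Thm. 12.5 (1) (p. 221), §15.16 and (15.16.1) (p. 265), Lemma 15.13 (p. 264), §15.15, Prop. 15.17 (p. 265)]
[cite: Kobayashi2003, §8.4, (8.23) (p. 18), Prop. 8.25–8.26 (pp. 24–25)] [cite: JohnsonLeungKings2011, Thm. 5.2, Thm. 5.7 and §7.2] -/
theorem zetaErlKSideCMTwo_of_erlKSideOnDisplayedHonda
    (hX :
      ∀ (v : HeightOneSpectrum (𝓞 ℚ)), ((2 : ℕ) : 𝓞 ℚ) ∈ v.asIdeal →
      ∀ (A : WeierstrassCurve ℚ) [A.IsElliptic] [A.IsGloballyMinimal],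
        A.HasCM → A.analyticRank = 0 → GoodSS A 2 → A.frobeniusTrace 2 = 0 →
        2 ∣ A.shaOrder * A.tamagawaProduct →
        ∀ (κ : ZpExtension ℚ 2) (γ : Field.absoluteGaloisGroup ℚ),
          κ.IsCyclotomic → κ.IsTopGenerator γ → IsCyclotomicVariable 2 γ →
        ∀ [NeZero (A.conductorNorm ℤ)] (f : CuspForm (Gamma0 (A.conductorNorm ℤ)) 2),
          IsNewformOf A f → ∀ (ϖ : ℚ), (ϖ : ℝ) * A.realPeriodRat = plusPeriod f →
        ∀ (Lplus Lminus : IwasawaAlgebra 2), IsPollackPair f 2 Lplus Lminus →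
        ∀ [ContinuousSMul ℤ_[2] (A.tateModule 2)] (Y : A.FineSelmerDualData κ γ),
        ∀ 𝔭' : PrimeSpectrum (IwasawaAlgebra 2), 𝔭'.asIdeal.height = 1 →
          PowerSeries.C (2 : ℤ_[2]) ∉ 𝔭'.asIdeal →
        ∀ (I : Kato2004.IwasawaH1Data A 2 κ γ)
          (pair : ∀ n : ℕ, H1 (tateRep A 2) (κ.layerSubgroup n) →ₗ[ℤ_[2]]
            (localLayerPointsOfEmb κ (closureEmb (K := ℚ) (v.adicCompletion ℚ)) A n →+ ℤ_[2])),
          -- (P1) projection formula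
          (∀ (n : ℕ) (x : H1 (tateRep A 2) (κ.layerSubgroup (n + 1))) (Q : localPoints A (v.adicCompletion ℚ))
            (hQ : Q ∈ localLayerPointsOfEmb κ (closureEmb (K := ℚ) (v.adicCompletion ℚ)) A n),
            pair n (layerCores (tateRep A 2) κ n x) ⟨Q, hQ⟩ =
              pair (n + 1) x ⟨Q, localLayerPointsOfEmb_mono κ (closureEmb (K := ℚ) (v.adicCompletion ℚ)) A (Nat.le_succ n) hQ⟩) →
          -- (P2) Galois invariance, for EVERY `g ∈ Γ_v`
          (∀ (n : ℕ) (g : Field.absoluteGaloisGroup (v.adicCompletion ℚ)) (y : H1 (tateRep A 2) (κ.layerSubgroup n))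
            (Q : localPoints A (v.adicCompletion ℚ))
            (hQ : Q ∈ localLayerPointsOfEmb κ (closureEmb (K := ℚ) (v.adicCompletion ℚ)) A n),
            pair n (conjMap (tateRep A 2).toTopRep (κ.layerSubgroup n) (resGalOfEmb (closureEmb (K := ℚ) (v.adicCompletion ℚ)) g) 1 y)
              ⟨g • Q, smul_mem_localLayerPointsOfEmb κ (closureEmb (K := ℚ) (v.adicCompletion ℚ)) A n g hQ⟩ = pair n y ⟨Q, hQ⟩) →
          -- (P3) residue clause: `pair` IS the `T₂A`-adic local Tate pairing (THE Weil pairings of the tree)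
          (∀ (n k : ℕ) (x : H1 (tateRep A 2) (κ.layerSubgroup n))
            (Q : localLayerPointsOfEmb κ (closureEmb (K := ℚ) (v.adicCompletion ℚ)) A n),
            PadicInt.toZModPow k (pair n x Q) =
              LayerPairing.layerPairingPk A κ v (LayerPairing.weilTowerPk A) (LayerPairing.weilTowerPk_pow A)
                (LayerPairing.weilTowerPk_add_left A) (LayerPairing.weilTowerPk_add_right A) (LayerPairing.weilTowerPk_smul A)
                n k x Q) →
        -- THE DISPLAYED 2-ADIC FRAME at `v` (output of `SignedEC.exists_model_padic_adicCompletion`)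
        ∀ (Φ : AlgebraicClosure ℚ_[2] ≃ₐ[ℚ] AlgebraicClosure (v.adicCompletion ℚ)) (φ : ℚ_[2] ≃+* v.adicCompletion ℚ)
          (hΦφ : ∀ y : ℚ_[2], Φ (algebraMap ℚ_[2] (AlgebraicClosure ℚ_[2]) y) =
            algebraMap (v.adicCompletion ℚ) (AlgebraicClosure (v.adicCompletion ℚ)) (φ y))
          (ι : AlgebraicClosure ℚ →ₐ[ℚ] AlgebraicClosure ℚ_[2]),
          (∀ z, closureEmb (K := ℚ) (v.adicCompletion ℚ) z = Φ (ι z)) →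
        -- THE DISPLAYED HONDA DATA WITH LOGARITHMS (output of `SignedEC.PlusLayer.plusHondaSystemTwo_adicCompletion_withLog`)
        ∀ (c : ℕ → localPoints A ℚ_[2]) (σ : ℕ → Field.absoluteGaloisGroup ℚ_[2]) (d₀ : ℕ → localPoints A ℚ_[2])
          (d : ℕ → localPoints A (v.adicCompletion ℚ)),
          (haveI := isIntegral_genFib_baseChange 2 ((integralModelInt A).map (Int.castRingHom ℤ_[2]))
            ∀ m, (toLoc ((genFibΩ_eq_baseChange ((integralModelInt A).map (Int.castRingHom ℤ_[2]))).trans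
                  (baseChange_twoAdicModel A))).symm (c m) ∈
                subfieldPoints (genFibΩ 2 ((integralModelInt A).map (Int.castRingHom ℤ_[2]))) (layer 2 m).toSubfield
                  coeffs_mem_layer ∧
              (toLoc ((genFibΩ_eq_baseChange ((integralModelInt A).map (Int.castRingHom ℤ_[2]))).trans
                  (baseChange_twoAdicModel A))).symm (c m) ∈
                kernel (Valued.v (R := PadicAlgCl 2)) (genFibΩ 2 ((integralModelInt A).map (Int.castRingHom ℤ_[2]))) ∧
              ptLogΩ 2 ((integralModelInt A).map (Int.castRingHom ℤ_[2]))
                ((toLoc ((genFibΩ_eq_baseChange ((integralModelInt A).map (Int.castRingHom ℤ_[2]))).trans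
                  (baseChange_twoAdicModel A))).symm (c m)) = ell 2 m) →
          (∀ m, ∀ τ ∈ stab 2 m, τ • c m = c m) →
          (∀ m, 1 ≤ m → σ m • zeta 2 m = (zeta 2 m)⁻¹) →
          (∀ n, d₀ n = 3 • (c (n + 2) + σ (n + 2) • c (n + 2)) - 2 • c 1) →
          (∀ m, d₀ m ∈ localLayerPointsOfEmb κ ι A m) →
          (∀ m, d m = WeierstrassCurve.Affine.Point.map (W' := A)
            (Φ : AlgebraicClosure ℚ_[2] →ₐ[ℚ] AlgebraicClosure (v.adicCompletion ℚ))
            (show (A.baseChange (AlgebraicClosure ℚ_[2])).toAffine.Point from d₀ m)) →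
          (∀ m, d m ∈ localLayerPointsOfEmb κ (closureEmb (K := ℚ) (v.adicCompletion ℚ)) A m) →
          (∀ m, localTraceOfEmb κ (closureEmb (K := ℚ) (v.adicCompletion ℚ)) A (m + 1) (m + 2) (d (m + 2)) = -d m) →
          (∀ m : ℕ, 1 ≤ m → ∀ P ∈ localLayerPointsOfEmb κ (closureEmb (K := ℚ) (v.adicCompletion ℚ)) A m,
            ∃ B ∈ AddSubgroup.closure (Set.range fun τ : Field.absoluteGaloisGroup (v.adicCompletion ℚ) ↦ τ • d m),
              ∃ P' ∈ localLayerPointsOfEmb κ (closureEmb (K := ℚ) (v.adicCompletion ℚ)) A (m - 1),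
              ∃ R ∈ localLayerPointsOfEmb κ (closureEmb (K := ℚ) (v.adicCompletion ℚ)) A m, P = B + P' + 2 • R) →
          (∀ P ∈ localLayerPointsOfEmb κ (closureEmb (K := ℚ) (v.adicCompletion ℚ)) A 0,
            ∃ a : ℤ, ∃ R ∈ localLayerPointsOfEmb κ (closureEmb (K := ℚ) (v.adicCompletion ℚ)) A 0, P = a • d 0 + 2 • R) →
        -- THE DISPLAYED LOCAL VARIABLE (output of `SignedKatoOffTwo.LocalVar.exists_localVariable_two`)
        ∀ (g₀ : Field.absoluteGaloisGroup ℚ_[2]) (g : Field.absoluteGaloisGroup (v.adicCompletion ℚ)),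
          g = transportAut Φ.toRingEquiv g₀ (SignedEC.modelFix Φ φ hΦφ g₀) →
          κ.IsTopGenerator (resGalOfEmb ι g₀) →
          κ.IsTopGenerator (resGalOfEmb (closureEmb (K := ℚ) (v.adicCompletion ℚ)) g) →
          ((GaloisRep.cyclotomicCharacter ℚ_[2] 2 g₀ : ℤ_[2]ˣ) : ℤ_[2]) = 5 →
          ((GaloisRep.cyclotomicCharacter (v.adicCompletion ℚ) 2 g : ℤ_[2]ˣ) : ℤ_[2]) = 5 →
          (∀ m j : ℕ, g₀ ^ j • zeta 2 m = zeta 2 m ^ 5 ^ j) →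
          (∀ (k j : ℕ) (t : AlgebraicClosure (v.adicCompletion ℚ)), t ^ 2 ^ k = 1 → g ^ j • t = t ^ 5 ^ j) →
          (∀ (W : WeierstrassCurve ℚ) (j : ℕ) (P : localPoints W ℚ_[2]),
            (show localPoints W (v.adicCompletion ℚ) from
              WeierstrassCurve.Affine.Point.map (W' := W)
                (Φ : AlgebraicClosure ℚ_[2] →ₐ[ℚ] AlgebraicClosure (v.adicCompletion ℚ))
                (show (W.baseChange (AlgebraicClosure ℚ_[2])).toAffine.Point from (g₀ ^ j • P))) =
              g ^ j • (show localPoints W (v.adicCompletion ℚ) from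
                WeierstrassCurve.Affine.Point.map (W' := W)
                  (Φ : AlgebraicClosure ℚ_[2] →ₐ[ℚ] AlgebraicClosure (v.adicCompletion ℚ))
                  (show (W.baseChange (AlgebraicClosure ℚ_[2])).toAffine.Point from P))) →
        -- THE PRINT CORE for the displayed `(g, d)`: Kato's class with (ERL_pair) and the §15 K-side datum
        ∃ s : I.H,
          (∃ μ ν : IwasawaAlgebra 2, μ ∉ 𝔭'.asIdeal ∧ ν ∉ 𝔭'.asIdeal ∧
            ∀ n : ℕ, ∃ (m : ℕ) (q : IwasawaAlgebra 2),
              PowerSeries.C ((2 : ℚ_[2]) ^ m) *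
                  (iwasawaToPowerSeries 2 μ * ((mazurTateElement f 2 n).map (algebraMap ℚ ℚ_[2]) : PowerSeries ℚ_[2]) -
                    iwasawaToPowerSeries 2 (ν * pairingSum A (localLayerPointsOfEmb κ (closureEmb (K := ℚ) (v.adicCompletion ℚ)) A n)
                      g n (d n) (pair n (I.proj n s)))) =
                iwasawaToPowerSeries 2 (((cyclotomicOmega 2 n).map (Int.castRingHom ℤ_[2]) : PowerSeries ℤ_[2]) * q)) ∧
          Nonempty (KatoDescent.KSideDatum I Y s 𝔭')) :
    ∀ (v : HeightOneSpectrum (𝓞 ℚ)), ((2 : ℕ) : 𝓞 ℚ) ∈ v.asIdeal →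
      ∀ (A : WeierstrassCurve ℚ) [A.IsElliptic] [A.IsGloballyMinimal],
        A.HasCM → A.analyticRank = 0 → GoodSS A 2 → A.frobeniusTrace 2 = 0 →
        2 ∣ A.shaOrder * A.tamagawaProduct →
        ∀ (κ : ZpExtension ℚ 2) (γ : Field.absoluteGaloisGroup ℚ),
          κ.IsCyclotomic → κ.IsTopGenerator γ → IsCyclotomicVariable 2 γ →
        ∀ [NeZero (A.conductorNorm ℤ)] (f : CuspForm (Gamma0 (A.conductorNorm ℤ)) 2),
          IsNewformOf A f → ∀ (ϖ : ℚ), (ϖ : ℝ) * A.realPeriodRat = plusPeriod f →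
        ∀ (Lplus Lminus : IwasawaAlgebra 2), IsPollackPair f 2 Lplus Lminus →
        ∀ [ContinuousSMul ℤ_[2] (A.tateModule 2)] (Y : A.FineSelmerDualData κ γ),
        ∀ 𝔭' : PrimeSpectrum (IwasawaAlgebra 2), 𝔭'.asIdeal.height = 1 →
          PowerSeries.C (2 : ℤ_[2]) ∉ 𝔭'.asIdeal →
        ∀ (I : Kato2004.IwasawaH1Data A 2 κ γ)
          (pair : ∀ n : ℕ, H1 (tateRep A 2) (κ.layerSubgroup n) →ₗ[ℤ_[2]]
            (localLayerPointsOfEmb κ (closureEmb (K := ℚ) (v.adicCompletion ℚ)) A n →+ ℤ_[2])),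
          -- (P1) projection formula
          (∀ (n : ℕ) (x : H1 (tateRep A 2) (κ.layerSubgroup (n + 1))) (Q : localPoints A (v.adicCompletion ℚ))
            (hQ : Q ∈ localLayerPointsOfEmb κ (closureEmb (K := ℚ) (v.adicCompletion ℚ)) A n),
            pair n (layerCores (tateRep A 2) κ n x) ⟨Q, hQ⟩ =
              pair (n + 1) x ⟨Q, localLayerPointsOfEmb_mono κ (closureEmb (K := ℚ) (v.adicCompletion ℚ)) A (Nat.le_succ n) hQ⟩) →
          -- (P2) Galois invariance, for EVERY `g ∈ Γ_v`
          (∀ (n : ℕ) (g : Field.absoluteGaloisGroup (v.adicCompletion ℚ)) (y : H1 (tateRep A 2) (κ.layerSubgroup n))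
            (Q : localPoints A (v.adicCompletion ℚ))
            (hQ : Q ∈ localLayerPointsOfEmb κ (closureEmb (K := ℚ) (v.adicCompletion ℚ)) A n),
            pair n (conjMap (tateRep A 2).toTopRep (κ.layerSubgroup n) (resGalOfEmb (closureEmb (K := ℚ) (v.adicCompletion ℚ)) g) 1 y)
              ⟨g • Q, smul_mem_localLayerPointsOfEmb κ (closureEmb (K := ℚ) (v.adicCompletion ℚ)) A n g hQ⟩ = pair n y ⟨Q, hQ⟩) →
          -- (P3) residue clause: `pair` IS the `T₂A`-adic local Tate pairing (THE Weil pairings of the tree)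
          (∀ (n k : ℕ) (x : H1 (tateRep A 2) (κ.layerSubgroup n))
            (Q : localLayerPointsOfEmb κ (closureEmb (K := ℚ) (v.adicCompletion ℚ)) A n),
            PadicInt.toZModPow k (pair n x Q) =
              LayerPairing.layerPairingPk A κ v (LayerPairing.weilTowerPk A) (LayerPairing.weilTowerPk_pow A)
                (LayerPairing.weilTowerPk_add_left A) (LayerPairing.weilTowerPk_add_right A) (LayerPairing.weilTowerPk_smul A)
                n k x Q) →
        ∃ (g : Field.absoluteGaloisGroup (v.adicCompletion ℚ))
          (_ : κ.IsTopGenerator (resGalOfEmb (closureEmb (K := ℚ) (v.adicCompletion ℚ)) g))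
          (d : ℕ → localPoints A (v.adicCompletion ℚ)) (s : I.H),
          (∀ n, d n ∈ localLayerPointsOfEmb κ (closureEmb (K := ℚ) (v.adicCompletion ℚ)) A n) ∧
          (∀ n, localTraceOfEmb κ (closureEmb (K := ℚ) (v.adicCompletion ℚ)) A (n + 1) (n + 2) (d (n + 2)) = -d n) ∧
          (∀ n : ℕ, 1 ≤ n → ∀ P ∈ localLayerPointsOfEmb κ (closureEmb (K := ℚ) (v.adicCompletion ℚ)) A n,
            ∃ B ∈ AddSubgroup.closure (Set.range fun σ : Field.absoluteGaloisGroup (v.adicCompletion ℚ) ↦ σ • d n),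
              ∃ P' ∈ localLayerPointsOfEmb κ (closureEmb (K := ℚ) (v.adicCompletion ℚ)) A (n - 1),
              ∃ R ∈ localLayerPointsOfEmb κ (closureEmb (K := ℚ) (v.adicCompletion ℚ)) A n, P = B + P' + 2 • R) ∧
          (∀ P ∈ localLayerPointsOfEmb κ (closureEmb (K := ℚ) (v.adicCompletion ℚ)) A 0,
            ∃ a : ℤ, ∃ R ∈ localLayerPointsOfEmb κ (closureEmb (K := ℚ) (v.adicCompletion ℚ)) A 0, P = a • d 0 + 2 • R) ∧
          -- (ERL_pair) ON THE layer pairings: `ν·P_{n,d_n}(pair n (I.proj n s)) ≡ μ·θ_n (mod ω_n)` in `Λ ⊗ ℚ₂`, `μ, ν ∉ 𝔭'`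
          (∃ μ ν : IwasawaAlgebra 2, μ ∉ 𝔭'.asIdeal ∧ ν ∉ 𝔭'.asIdeal ∧
            ∀ n : ℕ, ∃ (m : ℕ) (q : IwasawaAlgebra 2),
              PowerSeries.C ((2 : ℚ_[2]) ^ m) *
                  (iwasawaToPowerSeries 2 μ * ((mazurTateElement f 2 n).map (algebraMap ℚ ℚ_[2]) : PowerSeries ℚ_[2]) -
                    iwasawaToPowerSeries 2 (ν * pairingSum A (localLayerPointsOfEmb κ (closureEmb (K := ℚ) (v.adicCompletion ℚ)) A n)
                      g n (d n) (pair n (I.proj n s)))) =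
                iwasawaToPowerSeries 2 (((cyclotomicOmega 2 n).map (Int.castRingHom ℤ_[2]) : PowerSeries ℤ_[2]) * q)) ∧
          -- (g)^ι REPLACED by its typed K-side input: ONE K-side datum (tower + JLK §7.2 + §15.1 + transport socket)
          Nonempty (Summit.BirchSwinnertonDyer.BirchSwinnertonDyer.Theorems.KatoDescent.KSideDatum I Y s 𝔭') := by
  intro v hv A _ _ hcm hr hss ha h2 κ γ hκ hγ hcv _ f hf ϖ hϖ Lplus Lminus hPP _ Y 𝔭' h𝔭' hp𝔭' I pair hP1 hP2 hP3
  have hv' : (2 : 𝓞 ℚ) ∈ v.asIdeal := by exact_mod_cast hv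
  obtain ⟨Φ, φ, hΦφ, ι, hι, c, σ, d₀, d, hcΩ, hcstab, hσ, hd₀, hd₀L, hdT, hL, hTR, hGEN, hGEN0⟩ :=
    SignedEC.PlusLayer.plusHondaSystemTwo_adicCompletion_withLog A hss ha κ hκ v hv'
  obtain ⟨g₀, g, hgdef, hgen₀, hgen, hχ₀, hχ, hζpow, hroots, hTg⟩ :=
    SignedKatoOffTwo.LocalVar.exists_localVariable_two hκ hγ hcv v Φ φ hΦφ ι hι
  obtain ⟨s, hERL, hK⟩ :=
    hX v hv A hcm hr hss ha h2 κ γ hκ hγ hcv f hf ϖ hϖ Lplus Lminus hPP Y 𝔭' h𝔭' hp𝔭' I pair hP1 hP2 hP3 Φ φ hΦφ ι hι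
      c σ d₀ d hcΩ hcstab hσ hd₀ hd₀L hdT hL hTR hGEN hGEN0 g₀ g hgdef hgen₀ hgen hχ₀ hχ hζpow hroots hTg
  exact ⟨g, hgen, d, s, hL, hTR, hGEN, hGEN0, hERL, hK⟩

/-- **C1 BY NAME ⟸ its print core on the displayed Honda system.** The route item `KatoZetaErlKSideCMAtTwoSupply`
(stmt-BirchSwinnertonDyer-28306, HOLD; the KZ text behind two `let`s, definitionally the conclusion of
`zetaErlKSideCMTwo_of_erlKSideOnDisplayedHonda`) from the same displayed hypothesis `hX`. With the landed certificates
`SignedLowerOffTwo.signedMainConjectureCMTwoRankZeroOfPubOfFlat_of_zetaErlKSide` (p638949) and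
`SignedLowerOffTwo.signedMainConjectureCMTwoRankZeroOfPub_of_katoZetaErlKSideCMAtTwoSupply` (p645558) the K2 column (26471, 24945) then
reads ⟸ `hX` alone. CONDITIONAL on `hX` (published input: Kato 2004 Thm. 12.5 (1) + §15 for `f_A` at `2`, JLK 2011 Thm. 5.7 §7.2);
closes nothing by itself; BSD is not proved by this. [cite: Kato2004Asterisque, Thm. 12.5 (1) (p. 221), (15.16.1), Lemma 15.13, §15.15, Prop. 15.17 (pp. 264–265)]
[cite: JohnsonLeungKings2011, Thm. 5.2, Thm. 5.7 and §7.2] [cite: Kobayashi2003, (8.23) (p. 18), Prop. 8.25–8.26 (pp. 24–25)] -/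
theorem katoZetaErlKSideCMAtTwoSupply_of_erlKSideOnDisplayedHonda
    (hX :
      ∀ (v : HeightOneSpectrum (𝓞 ℚ)), ((2 : ℕ) : 𝓞 ℚ) ∈ v.asIdeal →
      ∀ (A : WeierstrassCurve ℚ) [A.IsElliptic] [A.IsGloballyMinimal],
        A.HasCM → A.analyticRank = 0 → GoodSS A 2 → A.frobeniusTrace 2 = 0 →
        2 ∣ A.shaOrder * A.tamagawaProduct →
        ∀ (κ : ZpExtension ℚ 2) (γ : Field.absoluteGaloisGroup ℚ),
          κ.IsCyclotomic → κ.IsTopGenerator γ → IsCyclotomicVariable 2 γ →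
        ∀ [NeZero (A.conductorNorm ℤ)] (f : CuspForm (Gamma0 (A.conductorNorm ℤ)) 2),
          IsNewformOf A f → ∀ (ϖ : ℚ), (ϖ : ℝ) * A.realPeriodRat = plusPeriod f →
        ∀ (Lplus Lminus : IwasawaAlgebra 2), IsPollackPair f 2 Lplus Lminus →
        ∀ [ContinuousSMul ℤ_[2] (A.tateModule 2)] (Y : A.FineSelmerDualData κ γ),
        ∀ 𝔭' : PrimeSpectrum (IwasawaAlgebra 2), 𝔭'.asIdeal.height = 1 →
          PowerSeries.C (2 : ℤ_[2]) ∉ 𝔭'.asIdeal →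
        ∀ (I : Kato2004.IwasawaH1Data A 2 κ γ)
          (pair : ∀ n : ℕ, H1 (tateRep A 2) (κ.layerSubgroup n) →ₗ[ℤ_[2]]
            (localLayerPointsOfEmb κ (closureEmb (K := ℚ) (v.adicCompletion ℚ)) A n →+ ℤ_[2])),
          (∀ (n : ℕ) (x : H1 (tateRep A 2) (κ.layerSubgroup (n + 1))) (Q : localPoints A (v.adicCompletion ℚ))
            (hQ : Q ∈ localLayerPointsOfEmb κ (closureEmb (K := ℚ) (v.adicCompletion ℚ)) A n),
            pair n (layerCores (tateRep A 2) κ n x) ⟨Q, hQ⟩ =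
              pair (n + 1) x ⟨Q, localLayerPointsOfEmb_mono κ (closureEmb (K := ℚ) (v.adicCompletion ℚ)) A (Nat.le_succ n) hQ⟩) →
          (∀ (n : ℕ) (g : Field.absoluteGaloisGroup (v.adicCompletion ℚ)) (y : H1 (tateRep A 2) (κ.layerSubgroup n))
            (Q : localPoints A (v.adicCompletion ℚ))
            (hQ : Q ∈ localLayerPointsOfEmb κ (closureEmb (K := ℚ) (v.adicCompletion ℚ)) A n),
            pair n (conjMap (tateRep A 2).toTopRep (κ.layerSubgroup n) (resGalOfEmb (closureEmb (K := ℚ) (v.adicCompletion ℚ)) g) 1 y)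
              ⟨g • Q, smul_mem_localLayerPointsOfEmb κ (closureEmb (K := ℚ) (v.adicCompletion ℚ)) A n g hQ⟩ = pair n y ⟨Q, hQ⟩) →
          (∀ (n k : ℕ) (x : H1 (tateRep A 2) (κ.layerSubgroup n))
            (Q : localLayerPointsOfEmb κ (closureEmb (K := ℚ) (v.adicCompletion ℚ)) A n),
            PadicInt.toZModPow k (pair n x Q) =
              LayerPairing.layerPairingPk A κ v (LayerPairing.weilTowerPk A) (LayerPairing.weilTowerPk_pow A)
                (LayerPairing.weilTowerPk_add_left A) (LayerPairing.weilTowerPk_add_right A) (LayerPairing.weilTowerPk_smul A)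
                n k x Q) →
        ∀ (Φ : AlgebraicClosure ℚ_[2] ≃ₐ[ℚ] AlgebraicClosure (v.adicCompletion ℚ)) (φ : ℚ_[2] ≃+* v.adicCompletion ℚ)
          (hΦφ : ∀ y : ℚ_[2], Φ (algebraMap ℚ_[2] (AlgebraicClosure ℚ_[2]) y) =
            algebraMap (v.adicCompletion ℚ) (AlgebraicClosure (v.adicCompletion ℚ)) (φ y))
          (ι : AlgebraicClosure ℚ →ₐ[ℚ] AlgebraicClosure ℚ_[2]),
          (∀ z, closureEmb (K := ℚ) (v.adicCompletion ℚ) z = Φ (ι z)) →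
        ∀ (c : ℕ → localPoints A ℚ_[2]) (σ : ℕ → Field.absoluteGaloisGroup ℚ_[2]) (d₀ : ℕ → localPoints A ℚ_[2])
          (d : ℕ → localPoints A (v.adicCompletion ℚ)),
          (haveI := isIntegral_genFib_baseChange 2 ((integralModelInt A).map (Int.castRingHom ℤ_[2]))
            ∀ m, (toLoc ((genFibΩ_eq_baseChange ((integralModelInt A).map (Int.castRingHom ℤ_[2]))).trans
                  (baseChange_twoAdicModel A))).symm (c m) ∈
                subfieldPoints (genFibΩ 2 ((integralModelInt A).map (Int.castRingHom ℤ_[2]))) (layer 2 m).toSubfield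
                  coeffs_mem_layer ∧
              (toLoc ((genFibΩ_eq_baseChange ((integralModelInt A).map (Int.castRingHom ℤ_[2]))).trans
                  (baseChange_twoAdicModel A))).symm (c m) ∈
                kernel (Valued.v (R := PadicAlgCl 2)) (genFibΩ 2 ((integralModelInt A).map (Int.castRingHom ℤ_[2]))) ∧
              ptLogΩ 2 ((integralModelInt A).map (Int.castRingHom ℤ_[2]))
                ((toLoc ((genFibΩ_eq_baseChange ((integralModelInt A).map (Int.castRingHom ℤ_[2]))).trans
                  (baseChange_twoAdicModel A))).symm (c m)) = ell 2 m) →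
          (∀ m, ∀ τ ∈ stab 2 m, τ • c m = c m) →
          (∀ m, 1 ≤ m → σ m • zeta 2 m = (zeta 2 m)⁻¹) →
          (∀ n, d₀ n = 3 • (c (n + 2) + σ (n + 2) • c (n + 2)) - 2 • c 1) →
          (∀ m, d₀ m ∈ localLayerPointsOfEmb κ ι A m) →
          (∀ m, d m = WeierstrassCurve.Affine.Point.map (W' := A)
            (Φ : AlgebraicClosure ℚ_[2] →ₐ[ℚ] AlgebraicClosure (v.adicCompletion ℚ))
            (show (A.baseChange (AlgebraicClosure ℚ_[2])).toAffine.Point from d₀ m)) →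
          (∀ m, d m ∈ localLayerPointsOfEmb κ (closureEmb (K := ℚ) (v.adicCompletion ℚ)) A m) →
          (∀ m, localTraceOfEmb κ (closureEmb (K := ℚ) (v.adicCompletion ℚ)) A (m + 1) (m + 2) (d (m + 2)) = -d m) →
          (∀ m : ℕ, 1 ≤ m → ∀ P ∈ localLayerPointsOfEmb κ (closureEmb (K := ℚ) (v.adicCompletion ℚ)) A m,
            ∃ B ∈ AddSubgroup.closure (Set.range fun τ : Field.absoluteGaloisGroup (v.adicCompletion ℚ) ↦ τ • d m),
              ∃ P' ∈ localLayerPointsOfEmb κ (closureEmb (K := ℚ) (v.adicCompletion ℚ)) A (m - 1),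
              ∃ R ∈ localLayerPointsOfEmb κ (closureEmb (K := ℚ) (v.adicCompletion ℚ)) A m, P = B + P' + 2 • R) →
          (∀ P ∈ localLayerPointsOfEmb κ (closureEmb (K := ℚ) (v.adicCompletion ℚ)) A 0,
            ∃ a : ℤ, ∃ R ∈ localLayerPointsOfEmb κ (closureEmb (K := ℚ) (v.adicCompletion ℚ)) A 0, P = a • d 0 + 2 • R) →
        ∀ (g₀ : Field.absoluteGaloisGroup ℚ_[2]) (g : Field.absoluteGaloisGroup (v.adicCompletion ℚ)),
          g = transportAut Φ.toRingEquiv g₀ (SignedEC.modelFix Φ φ hΦφ g₀) →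
          κ.IsTopGenerator (resGalOfEmb ι g₀) →
          κ.IsTopGenerator (resGalOfEmb (closureEmb (K := ℚ) (v.adicCompletion ℚ)) g) →
          ((GaloisRep.cyclotomicCharacter ℚ_[2] 2 g₀ : ℤ_[2]ˣ) : ℤ_[2]) = 5 →
          ((GaloisRep.cyclotomicCharacter (v.adicCompletion ℚ) 2 g : ℤ_[2]ˣ) : ℤ_[2]) = 5 →
          (∀ m j : ℕ, g₀ ^ j • zeta 2 m = zeta 2 m ^ 5 ^ j) →
          (∀ (k j : ℕ) (t : AlgebraicClosure (v.adicCompletion ℚ)), t ^ 2 ^ k = 1 → g ^ j • t = t ^ 5 ^ j) →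
          (∀ (W : WeierstrassCurve ℚ) (j : ℕ) (P : localPoints W ℚ_[2]),
            (show localPoints W (v.adicCompletion ℚ) from
              WeierstrassCurve.Affine.Point.map (W' := W)
                (Φ : AlgebraicClosure ℚ_[2] →ₐ[ℚ] AlgebraicClosure (v.adicCompletion ℚ))
                (show (W.baseChange (AlgebraicClosure ℚ_[2])).toAffine.Point from (g₀ ^ j • P))) =
              g ^ j • (show localPoints W (v.adicCompletion ℚ) from
                WeierstrassCurve.Affine.Point.map (W' := W)
                  (Φ : AlgebraicClosure ℚ_[2] →ₐ[ℚ] AlgebraicClosure (v.adicCompletion ℚ))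
                  (show (W.baseChange (AlgebraicClosure ℚ_[2])).toAffine.Point from P))) →
        ∃ s : I.H,
          (∃ μ ν : IwasawaAlgebra 2, μ ∉ 𝔭'.asIdeal ∧ ν ∉ 𝔭'.asIdeal ∧
            ∀ n : ℕ, ∃ (m : ℕ) (q : IwasawaAlgebra 2),
              PowerSeries.C ((2 : ℚ_[2]) ^ m) *
                  (iwasawaToPowerSeries 2 μ * ((mazurTateElement f 2 n).map (algebraMap ℚ ℚ_[2]) : PowerSeries ℚ_[2]) -
                    iwasawaToPowerSeries 2 (ν * pairingSum A (localLayerPointsOfEmb κ (closureEmb (K := ℚ) (v.adicCompletion ℚ)) A n)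
                      g n (d n) (pair n (I.proj n s)))) =
                iwasawaToPowerSeries 2 (((cyclotomicOmega 2 n).map (Int.castRingHom ℤ_[2]) : PowerSeries ℤ_[2]) * q)) ∧
          Nonempty (KatoDescent.KSideDatum I Y s 𝔭')) :
    Summit.BirchSwinnertonDyer.BirchSwinnertonDyer.Theses.ThetaPartnerAtTwo.KatoZetaErlKSideCMAtTwoSupply :=
  zetaErlKSideCMTwo_of_erlKSideOnDisplayedHonda hX

end Summit.BirchSwinnertonDyer.BirchSwinnertonDyer.Theorems.KatoZetaErlKSideCMAtTwo

end
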